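import Mathlib
import Summits.ResolutionOfSingularities.ResolutionOfSingularities.Theorems.HomologicalConductorPersistenceConductorCoextension
import Summits.ResolutionOfSingularities.ResolutionOfSingularities.Theorems.HomologicalConductorPersistenceCyclicTransferSyzygy
import Summits.ResolutionOfSingularities.ResolutionOfSingularities.Theorems.HomologicalConductorPersistenceConductorCeiling
import Summits.ResolutionOfSingularities.ResolutionOfSingularities.Theorems.HomologicalConductorPersistenceSurfaceSaturationResidualTwo
import HarnessLib

/-!
# Rung S-2 `PersistenceSurface` (stmt-ResolutionOfSingularities-19970) — the CONDUCTOR FLOOR for a PRINCIPAL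
# conductor: `𝔠²·ca³(C) ⊆ ca³(B)` when `𝔠 = a·C`

Route `ResolutionOfSingularities/HomologicalConductor`, chain W4.4b (cell `res-hironaka`), rung S-2
`PersistenceSurface` (stmt-ResolutionOfSingularities-19970), registered stub
`stub_levelFourPersistenceNonnormalOrNonrational'` (L-other′; class Σ8 = NON-NORMAL stage `0`), cell R5 / S-c.
Seat res-L1-w44b-lead-1 (gen 3).  Completes the programme of `…PersistenceConductorCeiling` (p550697: `ca³(B) ⊆ 𝔠`)
and `…PersistenceConductorCoextension` (p551581: the algebraic core of the transfer).  `[OURS · L1 w44b]`; folklore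
module theory; NOT a statement of the manuscript under review (Hironaka 2017); AI-written, weaker than expert review.

## Setting and statement
`B → C` injective map of commutative noetherian rings, `C` a domain, BIRATIONAL (`∀ γ ∃ b ≠ 0, bγ ∈ B`), with PRINCIPAL
conductor `𝔠 = a·C` (`a ∈ B`, `a ≠ 0` in `C`, `a·C ⊆ B`, `𝔠 ⊆ a·C`); `W(K) = Hom_B(C, K)` the coextension with its
`C`-structure (Mathlib `ModuleCat.CoextendScalars`, spelled as in `…PersistenceCyclicTransferCoinduced`).
Contents: `algebraMap_apply_eq_mul` (B-linear forms on `C` are `C`-linear) · `exists_linearEquiv_coext_pi`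
(`W(Bⁿ) ≅ Cⁿ`) · `finite_projective_coext` (`W(P)` f.g. projective) · `exists_linearEquiv_coext_ker` (`W(ker φ) ≅ ker W(φ)`)
· `exists_isSyzygy_two_coext` (2nd `B`-syzygy ⇒ `W` is a 2nd `C`-syzygy; tree `isSyzygy_two_ker`) ·
`exists_coext_factor_of_mem_cohomologyAnnihilatorOfDegree_three` (`y ∈ ca³(C)` factors on `W(K)`) ·
**`mul_mem_cohomologyAnnihilatorOfDegree_three_of_conductor`** (THE FLOOR: `c·(c'y) ∈ ca³(B)`; CA1 + p551581) ·
`mul_mul_mem_cohomologyAnnihilatorOfDegree_three` (`a·(a·y) ∈ ca³(B)`) · appendix: the ceiling at all levels for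
hypersurface germs of dimension `≤ 2`.

With the ceiling (p550697): **`a²·ca³(C) ⊆ ca³(B) ⊆ a·C`** — the first typed instance of the planner's transitivity
heuristic R5 (the centre of a non-normal stage with principal conductor is pinched between `a²·ca³(T̄₀)` and `a·T̄₀`).
References (mechanism only): S. B. Iyengar, R. Takahashi, IMRN 2016, Remark 2.13 [`IyengarTakahashi2014`].
-/

-- single-problem summit: the doubled namespace component `ResolutionOfSingularities` is forced
set_option linter.dupNamespace false

noncomputable section

open CategoryTheory Literature.RingTheory.CohomologyAnnihilator
open Summit.ResolutionOfSingularities.ResolutionOfSingularities.Theorems.NoZeno.SandwichCluster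
open Summit.ResolutionOfSingularities.ResolutionOfSingularities.Theorems.HomologicalConductor.PersistenceCyclicTransferCoinduced
  (isScalarTower_coinduced)
open Summit.ResolutionOfSingularities.ResolutionOfSingularities.Theorems.HomologicalConductor.PersistenceCyclicTransferSyzygy
  (isSyzygy_two_ker)
open Summit.ResolutionOfSingularities.ResolutionOfSingularities.Theorems.HomologicalConductor.PersistenceConductorCoextension
  (exists_linearMap_conductor stablyAnnihilates_of_coextension_factor)

universe u

namespace Summit.ResolutionOfSingularities.ResolutionOfSingularities.Theorems.HomologicalConductor.PersistenceConductorFloor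

variable {B C : Type u} [CommRing B] [CommRing C] [Algebra B C]

/-! ## `B`-linear maps out of `C` are `C`-linear -/

/-- For `B → C` injective and birational with `C` a domain, every `B`-linear `θ : C|_B → B` satisfies
`θ(γ) = γ·θ(1)` in `C` (clear the denominator of `γ`). [folklore] -/
theorem algebraMap_apply_eq_mul [IsDomain C] (hinj : Function.Injective (algebraMap B C))
    (hbir : ∀ γ : C, ∃ b : B, b ≠ 0 ∧ ∃ b' : B, algebraMap B C b' = algebraMap B C b * γ)
    (θ : ((ModuleCat.restrictScalars (algebraMap B C)).obj (ModuleCat.of C C)) →ₗ[B] B) (γ : C) :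
    algebraMap B C (θ γ) = γ * algebraMap B C (θ (1 : C)) := by
  let toW : C → ((ModuleCat.restrictScalars (algebraMap B C)).obj (ModuleCat.of C C)) := fun v => v
  let ofW : ((ModuleCat.restrictScalars (algebraMap B C)).obj (ModuleCat.of C C)) → C := fun w => w
  have ofW_smul : ∀ (r : B) (w : ((ModuleCat.restrictScalars (algebraMap B C)).obj (ModuleCat.of C C))),
      ofW (r • w) = algebraMap B C r * ofW w := fun r w => by
    rw [ModuleCat.restrictScalars.smul_def (M := ModuleCat.of C C)]
    rfl
  obtain ⟨b, hb0, b', hb'⟩ := hbir γ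
  have hbC : algebraMap B C b ≠ 0 := fun h => hb0 (hinj (by rw [h, map_zero]))
  -- `b • γ = b' • 1` in `C|_B`
  have h1 : b • toW γ = b' • toW 1 := by
    change toW (ofW (b • toW γ)) = toW (ofW (b' • toW 1))
    rw [ofW_smul, ofW_smul]
    change toW (algebraMap B C b * γ) = toW (algebraMap B C b' * 1)
    rw [mul_one, hb']
  have h2 : b * θ (toW γ) = b' * θ (toW 1) := by
    rw [← smul_eq_mul, ← smul_eq_mul, ← map_smul, ← map_smul, h1]
  have h3 : algebraMap B C b * algebraMap B C (θ (toW γ)) =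
      algebraMap B C b * (γ * algebraMap B C (θ (toW 1))) := by
    rw [← map_mul, h2, map_mul, hb']
    ring
  exact mul_left_cancel₀ hbC h3

/-! ## The coextension of a finite free module: `W(Bⁿ) ≅ Cⁿ` for a principal conductor -/

/-- **`W(Bⁿ) = Hom_B(C, Bⁿ) ≅ Cⁿ` as `C`-modules** when the conductor is principal, `𝔠 = a·C`
(`a·C ⊆ B`, `𝔠 ⊆ a·C`, `a ≠ 0` in the domain `C`): `θ ↦ (wᵢ)` with `θᵢ(1) = a·wᵢ`. [folklore] -/
theorem exists_linearEquiv_coext_pi [IsDomain C] (hinj : Function.Injective (algebraMap B C))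
    (hbir : ∀ γ : C, ∃ b : B, b ≠ 0 ∧ ∃ b' : B, algebraMap B C b' = algebraMap B C b * γ)
    {a : B} (ha : ∀ γ : C, ∃ b : B, algebraMap B C b = algebraMap B C a * γ)
    (ha0 : algebraMap B C a ≠ 0)
    (h𝔠 : ∀ b : B, (∀ γ : C, ∃ b' : B, algebraMap B C b' = algebraMap B C b * γ) →
      ∃ w : C, algebraMap B C b = algebraMap B C a * w)
    (n : ℕ) :
    Nonempty ((((ModuleCat.restrictScalars (algebraMap B C)).obj (ModuleCat.of C C)) →ₗ[B] (Fin n → B))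
      ≃ₗ[C] (Fin n → C)) := by
  classical
  let toW : C → ((ModuleCat.restrictScalars (algebraMap B C)).obj (ModuleCat.of C C)) := fun v => v
  let ofW : ((ModuleCat.restrictScalars (algebraMap B C)).obj (ModuleCat.of C C)) → C := fun w => w
  have ofW_smul : ∀ (r : B) (w : ((ModuleCat.restrictScalars (algebraMap B C)).obj (ModuleCat.of C C))),
      ofW (r • w) = algebraMap B C r * ofW w := fun r w => by
    rw [ModuleCat.restrictScalars.smul_def (M := ModuleCat.of C C)]
    rfl
  have smul_apply'' : ∀ (s : C)
      (θ : ((ModuleCat.restrictScalars (algebraMap B C)).obj (ModuleCat.of C C)) →ₗ[B] (Fin n → B)) (w),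
      (s • θ) w = θ (toW (ofW w * s)) := fun _ _ _ => rfl
  -- the components `θᵢ : C|_B → B` and their values at `1` lie in the conductor
  have hcomp : ∀ (θ : ((ModuleCat.restrictScalars (algebraMap B C)).obj (ModuleCat.of C C)) →ₗ[B]
      (Fin n → B)) (i : Fin n) (γ : C),
      algebraMap B C (θ (toW γ) i) = γ * algebraMap B C (θ (toW 1) i) := fun θ i γ =>
    algebraMap_apply_eq_mul hinj hbir ((LinearMap.proj i).comp θ) γ
  have hcond : ∀ (θ : ((ModuleCat.restrictScalars (algebraMap B C)).obj (ModuleCat.of C C)) →ₗ[B]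
      (Fin n → B)) (i : Fin n), ∃ w : C, algebraMap B C (θ (toW 1) i) = algebraMap B C a * w :=
    fun θ i => h𝔠 _ fun γ => ⟨θ (toW γ) i, by rw [hcomp, mul_comm]⟩
  choose w hw using hcond
  -- `Φ θ = (wᵢ)`
  have hw_char : ∀ θ i (v : C), algebraMap B C (θ (toW 1) i) = algebraMap B C a * v → w θ i = v :=
    fun θ i v hv => mul_left_cancel₀ ha0 (by rw [← hw, hv])
  let Φ : (((ModuleCat.restrictScalars (algebraMap B C)).obj (ModuleCat.of C C)) →ₗ[B] (Fin n → B))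
      →ₗ[C] (Fin n → C) :=
    { toFun := fun θ i => w θ i
      map_add' := fun θ θ' => by
        ext i
        apply hw_char
        rw [LinearMap.add_apply, Pi.add_apply, map_add, hw, hw, Pi.add_apply, mul_add]
      map_smul' := fun s θ => by
        ext i
        change w (s • θ) i = s * w θ i
        apply hw_char
        rw [smul_apply'']
        change algebraMap B C (θ (toW (1 * s)) i) = _
        rw [one_mul, hcomp, hw]
        ring }
  -- the inverse `v ↦ (γ ↦ (μ_a (γ vᵢ))ᵢ)`
  obtain ⟨μ, hμ⟩ := exists_linearMap_conductor hinj ha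
  let Ψ : (Fin n → C) → (((ModuleCat.restrictScalars (algebraMap B C)).obj (ModuleCat.of C C)) →ₗ[B]
      (Fin n → B)) := fun v =>
    { toFun := fun γ i => μ (ofW γ * v i)
      map_add' := fun γ δ => by
        ext i
        change μ ((ofW γ + ofW δ) * v i) = μ (ofW γ * v i) + μ (ofW δ * v i)
        rw [add_mul, map_add]
      map_smul' := fun r γ => by
        ext i
        rw [RingHom.id_apply, Pi.smul_apply, ofW_smul, mul_assoc, ← Algebra.smul_def, map_smul] }
  have hΨ : ∀ v γ i, Ψ v γ i = μ (ofW γ * v i) := fun _ _ _ => rfl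
  have hΦΨ : ∀ v, Φ (Ψ v) = v := by
    intro v
    ext i
    apply hw_char
    rw [hΨ, hμ]
    change algebraMap B C a * (1 * v i) = _
    rw [one_mul]
  have hΨΦ : ∀ θ, Ψ (Φ θ) = θ := by
    intro θ
    apply LinearMap.ext
    intro γ
    ext i
    apply hinj
    rw [hΨ, hμ]
    change algebraMap B C a * (ofW γ * w θ i) = algebraMap B C (θ (toW (ofW γ)) i)
    rw [hcomp, mul_left_comm, ← hw]
  exact ⟨LinearEquiv.ofBijective Φ ⟨fun θ θ' h => by rw [← hΨΦ θ, ← hΨΦ θ', h],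
    fun v => ⟨Ψ v, hΦΨ v⟩⟩⟩


/-! ## Coextensions of projectives are projective; left exactness -/

/-- **`W(P)` is finitely generated projective over `C`** for `P` finitely generated projective over `B`
(principal conductor): `W(P)` is a retract of `W(Bⁿ) ≅ Cⁿ`. [folklore] -/
theorem finite_projective_coext [IsDomain C] (hinj : Function.Injective (algebraMap B C))
    (hbir : ∀ γ : C, ∃ b : B, b ≠ 0 ∧ ∃ b' : B, algebraMap B C b' = algebraMap B C b * γ)
    {a : B} (ha : ∀ γ : C, ∃ b : B, algebraMap B C b = algebraMap B C a * γ)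
    (ha0 : algebraMap B C a ≠ 0)
    (h𝔠 : ∀ b : B, (∀ γ : C, ∃ b' : B, algebraMap B C b' = algebraMap B C b * γ) →
      ∃ w : C, algebraMap B C b = algebraMap B C a * w)
    (P : Type u) [AddCommGroup P] [Module B P] [Module.Finite B P] [Module.Projective B P] :
    Module.Finite C (((ModuleCat.restrictScalars (algebraMap B C)).obj (ModuleCat.of C C)) →ₗ[B] P) ∧
      Module.Projective C (((ModuleCat.restrictScalars (algebraMap B C)).obj (ModuleCat.of C C)) →ₗ[B] P) := by
  obtain ⟨n, q, hq⟩ := Module.Finite.exists_fin' B P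
  obtain ⟨sec, hsec⟩ := Module.projective_lifting_property q (LinearMap.id : P →ₗ[B] P) hq
  obtain ⟨e⟩ := exists_linearEquiv_coext_pi hinj hbir ha ha0 h𝔠 n
  -- postcompositions, `C`-linear for the coextended structures
  let Wq : (((ModuleCat.restrictScalars (algebraMap B C)).obj (ModuleCat.of C C)) →ₗ[B] (Fin n → B)) →ₗ[C]
      (((ModuleCat.restrictScalars (algebraMap B C)).obj (ModuleCat.of C C)) →ₗ[B] P) :=
    { toFun := fun θ => q ∘ₗ θ
      map_add' := fun θ θ' => LinearMap.comp_add _ _ _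
      map_smul' := fun s θ => by apply LinearMap.ext; intro w; rfl }
  let Ws : (((ModuleCat.restrictScalars (algebraMap B C)).obj (ModuleCat.of C C)) →ₗ[B] P) →ₗ[C]
      (((ModuleCat.restrictScalars (algebraMap B C)).obj (ModuleCat.of C C)) →ₗ[B] (Fin n → B)) :=
    { toFun := fun θ => sec ∘ₗ θ
      map_add' := fun θ θ' => LinearMap.comp_add _ _ _
      map_smul' := fun s θ => by apply LinearMap.ext; intro w; rfl }
  have hWqs : ∀ θ, Wq (Ws θ) = θ := by
    intro θ
    apply LinearMap.ext
    intro w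
    change q (sec (θ w)) = θ w
    rw [← LinearMap.comp_apply, hsec, LinearMap.id_apply]
  have hcomp : (Wq ∘ₗ e.symm.toLinearMap) ∘ₗ (e.toLinearMap ∘ₗ Ws) = LinearMap.id := by
    apply LinearMap.ext
    intro θ
    simp only [LinearMap.coe_comp, LinearEquiv.coe_coe, Function.comp_apply, LinearEquiv.symm_apply_apply,
      LinearMap.id_coe, id_eq]
    exact hWqs θ
  refine ⟨Module.Finite.of_surjective (Wq ∘ₗ e.symm.toLinearMap) fun θ => ⟨e (Ws θ), ?_⟩,
    Module.Projective.of_split (e.toLinearMap ∘ₗ Ws) (Wq ∘ₗ e.symm.toLinearMap) hcomp⟩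
  simp only [LinearMap.coe_comp, LinearEquiv.coe_coe, Function.comp_apply, LinearEquiv.symm_apply_apply]
  exact hWqs θ

/-- **Left exactness of the coextension**: if `f : K → P` is injective with `range f = ker φ` then
`W(K) ≅ ker W(φ)` as `C`-modules (`θ ↦ f ∘ θ`), where `W(φ) : W(P) → W(P')` is postcomposition. [folklore] -/
theorem exists_linearEquiv_coext_ker {K P P' : Type u} [AddCommGroup K] [Module B K] [AddCommGroup P]
    [Module B P] [AddCommGroup P'] [Module B P'] (f : K →ₗ[B] P) (hf : Function.Injective f)
    (φ : P →ₗ[B] P') (hfφ : LinearMap.range f = LinearMap.ker φ)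
    (Wφ : (((ModuleCat.restrictScalars (algebraMap B C)).obj (ModuleCat.of C C)) →ₗ[B] P) →ₗ[C]
      (((ModuleCat.restrictScalars (algebraMap B C)).obj (ModuleCat.of C C)) →ₗ[B] P'))
    (hWφ : ∀ θ, Wφ θ = φ ∘ₗ θ) :
    Nonempty ((((ModuleCat.restrictScalars (algebraMap B C)).obj (ModuleCat.of C C)) →ₗ[B] K) ≃ₗ[C]
      ↥(LinearMap.ker Wφ)) := by
  have hφf : ∀ k, φ (f k) = 0 := fun k =>
    LinearMap.mem_ker.mp (hfφ ▸ LinearMap.mem_range_self f k)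
  -- forward map
  let Φ : (((ModuleCat.restrictScalars (algebraMap B C)).obj (ModuleCat.of C C)) →ₗ[B] K) →ₗ[C]
      ↥(LinearMap.ker Wφ) :=
    { toFun := fun θ => ⟨f ∘ₗ θ, by
        rw [LinearMap.mem_ker, hWφ]
        apply LinearMap.ext
        intro w
        exact hφf (θ w)⟩
      map_add' := fun θ θ' => by
        apply Subtype.ext
        exact LinearMap.comp_add _ _ _
      map_smul' := fun s θ => by
        apply Subtype.ext
        apply LinearMap.ext
        intro w
        rfl }
  -- inverse: an `η` with `φ ∘ η = 0` takes values in `range f = ker φ`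
  have hmem : ∀ (η : ↥(LinearMap.ker Wφ)) (w), η.1 w ∈ LinearMap.range f := by
    intro η w
    rw [hfφ, LinearMap.mem_ker]
    have := η.2
    rw [LinearMap.mem_ker, hWφ] at this
    exact LinearMap.congr_fun this w
  let lift : ↥(LinearMap.ker Wφ) → (((ModuleCat.restrictScalars (algebraMap B C)).obj (ModuleCat.of C C))
      →ₗ[B] K) := fun η =>
    (LinearEquiv.ofInjective f hf).symm.toLinearMap ∘ₗ
      LinearMap.codRestrict (LinearMap.range f) η.1 (hmem η)
  have hlift : ∀ η w, f (lift η w) = η.1 w := by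
    intro η w
    exact LinearEquiv.ofInjective_symm_apply (h := hf) f ⟨η.1 w, hmem η w⟩
  refine ⟨LinearEquiv.ofBijective Φ ⟨?_, ?_⟩⟩
  · intro θ θ' h
    apply LinearMap.ext
    intro w
    apply hf
    have := congrArg (fun η : ↥(LinearMap.ker Wφ) => η.1 w) h
    exact this
  · intro η
    refine ⟨lift η, Subtype.ext (LinearMap.ext fun w => ?_)⟩
    exact hlift η w

/-! ## Second syzygies transfer to the coextension -/

/-- **`W(K)` is a second `C`-syzygy for every second `B`-syzygy `K`** (principal conductor; `C` noetherian).
[folklore] -/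
theorem exists_isSyzygy_two_coext [IsDomain C] [IsNoetherianRing C]
    (hinj : Function.Injective (algebraMap B C))
    (hbir : ∀ γ : C, ∃ b : B, b ≠ 0 ∧ ∃ b' : B, algebraMap B C b' = algebraMap B C b * γ)
    {a : B} (ha : ∀ γ : C, ∃ b : B, algebraMap B C b = algebraMap B C a * γ)
    (ha0 : algebraMap B C a ≠ 0)
    (h𝔠 : ∀ b : B, (∀ γ : C, ∃ b' : B, algebraMap B C b' = algebraMap B C b * γ) →
      ∃ w : C, algebraMap B C b = algebraMap B C a * w)
    {M K : ModuleCat.{u} B} (hK : IsSyzygy 2 M K) :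
    ∃ X : ModuleCat.{u} C, Module.Finite C X ∧
      IsSyzygy 2 X (ModuleCat.of C (((ModuleCat.restrictScalars (algebraMap B C)).obj (ModuleCat.of C C))
        →ₗ[B] K)) := by
  obtain ⟨K', P, h1, hPfin, hPproj, f, g, w, hS⟩ := hK
  obtain ⟨K'', P', -, hP'fin, hP'proj, f', g', w', hS'⟩ := h1
  haveI := hPfin
  haveI := hP'fin
  haveI : Module.Projective B P := (IsProjective.iff_projective (R := B) P).mpr hPproj
  haveI : Module.Projective B P' := (IsProjective.iff_projective (R := B) P').mpr hP'proj
  have hf : Function.Injective f.hom := (ModuleCat.mono_iff_injective f).mp hS.mono_f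
  have hf' : Function.Injective f'.hom := (ModuleCat.mono_iff_injective f').mp hS'.mono_f
  -- `K = ker (f' ∘ g : P → P')`
  let φ : P →ₗ[B] P' := f'.hom ∘ₗ g.hom
  have hfφ : LinearMap.range f.hom = LinearMap.ker φ := by
    rw [LinearMap.ker_comp_of_ker_eq_bot _ (LinearMap.ker_eq_bot.mpr hf')]
    exact hS.exact.moduleCat_range_eq_ker
  -- the coextended modules of `P`, `P'` are finitely generated projective over `C`
  obtain ⟨hWPfin, hWPproj⟩ := finite_projective_coext hinj hbir ha ha0 h𝔠 P
  obtain ⟨hWP'fin, hWP'proj⟩ := finite_projective_coext hinj hbir ha ha0 h𝔠 P'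
  let Wφ : (((ModuleCat.restrictScalars (algebraMap B C)).obj (ModuleCat.of C C)) →ₗ[B] P) →ₗ[C]
      (((ModuleCat.restrictScalars (algebraMap B C)).obj (ModuleCat.of C C)) →ₗ[B] P') :=
    { toFun := fun θ => φ ∘ₗ θ
      map_add' := fun θ θ' => LinearMap.comp_add _ _ _
      map_smul' := fun s θ => by apply LinearMap.ext; intro w; rfl }
  obtain ⟨e⟩ := exists_linearEquiv_coext_ker (C := C) f.hom hf φ hfφ Wφ (fun _ => rfl)
  have h2 := isSyzygy_two_ker Wφ
  exact ⟨_, inferInstance, h2.of_iso e.symm.toModuleIso⟩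

/-- **Every `y ∈ ca³(C)` factors on `W(K)`**: for a second `B`-syzygy `K`, `y • 𝟙_{W(K)}` factors `C`-linearly
through a finite free `C`-module (`y` kills `Ext¹_C(W(K), –) ≅ Ext³_C(X, –)` on finitely generated modules;
dual splitting criterion on a finite free presentation). [cite: IyengarTakahashi2014, Remark 2.13] -/
theorem exists_coext_factor_of_mem_cohomologyAnnihilatorOfDegree_three [IsDomain C] [IsNoetherianRing C]
    (hinj : Function.Injective (algebraMap B C))
    (hbir : ∀ γ : C, ∃ b : B, b ≠ 0 ∧ ∃ b' : B, algebraMap B C b' = algebraMap B C b * γ)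
    {a : B} (ha : ∀ γ : C, ∃ b : B, algebraMap B C b = algebraMap B C a * γ)
    (ha0 : algebraMap B C a ≠ 0)
    (h𝔠 : ∀ b : B, (∀ γ : C, ∃ b' : B, algebraMap B C b' = algebraMap B C b * γ) →
      ∃ w : C, algebraMap B C b = algebraMap B C a * w)
    {y : C} (hy : y ∈ cohomologyAnnihilatorOfDegree C 3)
    {M K : ModuleCat.{u} B} (hK : IsSyzygy 2 M K) :
    ∃ (m : ℕ)
      (ψ : (((ModuleCat.restrictScalars (algebraMap B C)).obj (ModuleCat.of C C)) →ₗ[B] K) →ₗ[C]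
        (Fin m → C))
      (g : (Fin m → C) →ₗ[C] (((ModuleCat.restrictScalars (algebraMap B C)).obj (ModuleCat.of C C))
        →ₗ[B] K)),
      ∀ θ, g (ψ θ) = y • θ := by
  obtain ⟨X, hX, hW⟩ := exists_isSyzygy_two_coext hinj hbir ha ha0 h𝔠 hK
  haveI := hX
  haveI : Module.Finite C (((ModuleCat.restrictScalars (algebraMap B C)).obj (ModuleCat.of C C)) →ₗ[B] K) :=
    finite_of_isSyzygy 2 hX hW
  obtain ⟨m, q, hq⟩ := Module.Finite.exists_fin' C
    (((ModuleCat.restrictScalars (algebraMap B C)).obj (ModuleCat.of C C)) →ₗ[B] K)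
  have hS := LinearMap.shortExact_shortComplexKer hq
  haveI : Module.Finite C (LinearMap.ker q) := Module.IsNoetherian.finite C _
  have hcls : y • hS.extClass = 0 :=
    ext_smul_eq_zero_of_isSyzygy 2 hW (ModuleCat.of C (LinearMap.ker q)) 1 le_rfl y
      (fun e' => smul_eq_zero_of_mem_cohomologyAnnihilatorOfDegree hy (by omega) e') _
  obtain ⟨ψ, hψ⟩ := exists_comp_eq_smul_id_X₃_of_smul_extClass_eq_zero hS hcls
  refine ⟨m, ψ.hom, q, fun θ => ?_⟩
  have := congrArg (fun χ => χ.hom θ) hψ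
  simpa using this

/-! ## The floor -/

/-- **THE CONDUCTOR FLOOR (principal conductor).**  `B → C` injective and birational, `B`, `C` noetherian, `C` a
domain, `a·C ⊆ B ⊇ 𝔠 ⊆ a·C` with `a ≠ 0`; for conductor elements `c, c'` and `y ∈ ca³(C)`, the element `c·b`
(`b = c'y` in `C`) lies in `ca³(B)`: every second `B`-syzygy `K` is stably annihilated by `c·b`
(`exists_coext_factor_of_mem_cohomologyAnnihilatorOfDegree_three` + `stablyAnnihilates_of_coextension_factor` +
CA1). [cite: IyengarTakahashi2014, Remark 2.13] -/
theorem mul_mem_cohomologyAnnihilatorOfDegree_three_of_conductor [IsNoetherianRing B] [IsDomain C]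
    [IsNoetherianRing C] (hinj : Function.Injective (algebraMap B C))
    (hbir : ∀ γ : C, ∃ b : B, b ≠ 0 ∧ ∃ b' : B, algebraMap B C b' = algebraMap B C b * γ)
    {a : B} (ha : ∀ γ : C, ∃ b : B, algebraMap B C b = algebraMap B C a * γ)
    (ha0 : algebraMap B C a ≠ 0)
    (h𝔠 : ∀ b : B, (∀ γ : C, ∃ b' : B, algebraMap B C b' = algebraMap B C b * γ) →
      ∃ w : C, algebraMap B C b = algebraMap B C a * w)
    {c c' : B} (hc : ∀ γ : C, ∃ b : B, algebraMap B C b = algebraMap B C c * γ)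
    (hc' : ∀ γ : C, ∃ b : B, algebraMap B C b = algebraMap B C c' * γ)
    {y : C} (hy : y ∈ cohomologyAnnihilatorOfDegree C 3) {b : B}
    (hb : algebraMap B C b = algebraMap B C c' * y) :
    c * b ∈ cohomologyAnnihilatorOfDegree B 3 := by
  refine (mem_cohomologyAnnihilatorOfDegree_succ_iff_forall_isSyzygy (n := 2) (c * b)).mpr
    fun M K hM hK => ?_
  obtain ⟨m, ψ, g, hψg⟩ := exists_coext_factor_of_mem_cohomologyAnnihilatorOfDegree_three hinj hbir ha ha0
    h𝔠 hy hK
  exact stablyAnnihilates_of_coextension_factor hinj hc hc' K hb ψ g hψg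

/-- **`a·(a·y) ∈ ca³(B)` for every `y ∈ ca³(C)`** (the case `c = c' = a`): `a²·ca³(C) ⊆ ca³(B)`; with the
ceiling `ca³(B) ⊆ a·C` (`…PersistenceConductorCeiling`) this pinches `ca³(B)` between `a²·ca³(C)` and `a·C`.
[cite: IyengarTakahashi2014, Remark 2.13] -/
theorem mul_mul_mem_cohomologyAnnihilatorOfDegree_three [IsNoetherianRing B] [IsDomain C]
    [IsNoetherianRing C] (hinj : Function.Injective (algebraMap B C))
    (hbir : ∀ γ : C, ∃ b : B, b ≠ 0 ∧ ∃ b' : B, algebraMap B C b' = algebraMap B C b * γ)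
    {a : B} (ha : ∀ γ : C, ∃ b : B, algebraMap B C b = algebraMap B C a * γ)
    (ha0 : algebraMap B C a ≠ 0)
    (h𝔠 : ∀ b : B, (∀ γ : C, ∃ b' : B, algebraMap B C b' = algebraMap B C b * γ) →
      ∃ w : C, algebraMap B C b = algebraMap B C a * w)
    {y : C} (hy : y ∈ cohomologyAnnihilatorOfDegree C 3) {b : B}
    (hb : algebraMap B C b = algebraMap B C a * y) :
    a * b ∈ cohomologyAnnihilatorOfDegree B 3 :=
  mul_mem_cohomologyAnnihilatorOfDegree_three_of_conductor hinj hbir ha ha0 h𝔠 ha ha hy hb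


/-! ## Appendix: the ceiling at all levels for hypersurface germs of dimension `≤ 2` -/

/-- **`ca(R) ⊆ 𝔠` at ALL levels for an abstract hypersurface of dimension `≤ 2`** (`IsRegularHypersurfaceQuotient d R`,
`d ≤ 2`, o9h: `ca = caᵈ⁺¹ ⊆ ca³`) and every module-finite intermediate ring `R ⊆ C ⊆ Frac R`: the whole cohomology
annihilator lies in the conductor (non-normal hypersurface surface germs: Whitney-umbrella type, curve × line, R5's
pinched A₃ cone). [OURS] -/
theorem cohomologyAnnihilator_le_conductor_of_isRegularHypersurfaceQuotient {R : Type} [CommRing R] [IsDomain R]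
    [IsNoetherianRing R] {K : Type} [Field K] [Algebra R K] [IsFractionRing R K] {d : ℕ} (hd : d ≤ 2)
    (hR : PersistenceSurfaceSaturationResidualTwo.IsRegularHypersurfaceQuotient d R)
    (M : Submodule R K) (hM1 : (1 : K) ∈ M) (hMmul : ∀ a ∈ M, ∀ b ∈ M, a * b ∈ M) (hMfg : M.FG)
    (𝔠 : Ideal R) (h𝔠 : ∀ r : R, r ∈ 𝔠 ↔ ∀ m ∈ M, ∃ r' : R, algebraMap R K r' = algebraMap R K r * m) :
    cohomologyAnnihilator R ≤ 𝔠 := by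
  rw [PersistenceSurfaceSaturationResidualTwo.cohomologyAnnihilator_eq_of_isRegularHypersurfaceQuotient hR]
  exact (cohomologyAnnihilatorOfDegree_mono (show d + 1 ≤ 3 by omega)).trans
    (PersistenceConductorCeiling.cohomologyAnnihilatorOfDegree_three_le_conductor M hM1 hMmul hMfg 𝔠 h𝔠)

end Summit.ResolutionOfSingularities.ResolutionOfSingularities.Theorems.HomologicalConductor.PersistenceConductorFloor

end
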